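import Summits.ABC.IUTFork.Cor312GenuineKWildExact
import Literature.IUT.LogVolume.DifferentOrdDivisor
import Literature.NumberTheory.NumberFields.DedekindDifferentBoundGeneral
import Literature.NumberTheory.NumberFields.DifferentIdealIntBase
import Literature.NumberTheory.NumberFields.RelativeDifferentExponents
import HarnessLib

/-!
# Two local inputs of the R-W wild-prime NEG engine: DEDEKIND's different bound at a completion (`d(K_u) ≤ (e − 1 + e·v_p(e))/e`) and the
# local-type CLASS of a genuine Θ-volume datum at a wild pole WITHOUT the `p ∤ t` hypothesis

PROOF-ONLY file (D-0012: 0 definitions, 0 `Prop` facts) of the abc-iut cell (rung LADDER-ABC:A2.RESCUE.W, lane P−; seat abc-iut-w4-d094 gen 8,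
row «W:FREY-PINNED-28»). TAKES NO SIDE on [IUTchIII] Cor. 3.12 or on any author; classical algebraic number theory over OUR typed genuine tower.

* §3 **`multiplicity_differentIdeal_int_le_dedekind`** — for EVERY number field `K` and EVERY finite place `u ∣ p`:
  `ord_u(𝔇_{K/ℤ}) ≤ e(u|p) − 1 + e(u|p)·v_p(e(u|p))` (Dedekind / Hensel / Lenstra; Neukirch III (2.6) «`s ≤ e − 1 + v_𝔓(e)`»): the tree's
  `multiplicity_differentIdeal_succ_le` (`Literature/NumberTheory/NumberFields/DedekindDifferentBoundGeneral`, every `M/L`) at `L = ℚ`, moved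
  from `𝓞 ℚ` to `ℤ` (`differentIdeal_int_eq_differentIdeal_ringOfIntegers_rat`; `e(u|𝓞_ℚ) = e(u|ℤ)`) with `ord_u((e)) = e(u|p)·v_p(e)`
  (`multiplicity_span_natCast`); **`differentOrd_rescaledCompletion_le_dedekind`** — the same bound for [IUTchIV]'s invariant `d` of the
  rescaled completion `K_u` (abc-iut-S1's `differentOrd_rescaledCompletion`). This is the WILD UPPER bound the R-W numerics lead's «Lenstra
  max `δ = e − 1 + e·v₃(e)`» presupposes — previously absent from the tree in `e`-form (only `d < 1 + v_p([K:ℚ_p])`,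
  `differentOrd_lt_one_add_padicValNat_finrank`).
* §4 **`GenuineK.ramificationIdx_F_wild_class_ratPoint`** — for a genuine Θ-volume datum `T` over `(ratPoint q₀, l)`, `{p, p′} = {3, 5}`, a pole
  of `j(q₀)` at `p` of order `2t` and a place `w ∣ p` of `F`: `A := e(w|p)` satisfies `(p−1) ∣ A`, `15 ∣ A·t`, `A ∣ p(p−1)p′`, `p′ ∣ t ⇒ A ∣ p(p−1)`
  — the four inputs of abc-iut-W-neg-1's `wild_index_eq` (`Cor312GenuineKWildExact`, which adds `p ∤ t` to pin `A = p(p−1)p′/gcd(p′,t)`),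
  here WITHOUT `p ∤ t`: at `p = 3` the class is `{10, 30}` (`5 ∤ t`), `{2, 6}` (`5 ∣ t`), `{30}` (`gcd(15, t) = 1`) — enough for the NEGATIVE
  side at the SPLIT (type W2, `q` a cube in `ℚ₃`) packets, where no exact local type is in the tree; `GenuineK.mul_prime_factorization_le_ite`
  (`(A·l)·v_p(A·l) ≤ [p ∣ A]·A·l` on the class).
HONEST FRAMING: bookkeeping over OUR typed objects; nothing here bears on the printed inequality of [IUTchIII] Cor. 3.12 or on the number-level
`Cor22.Cor312AtDatum`; typed ≠ proved; instantiated ≠ endorsed. [cite: NeukirchANT1999, Ch. III (2.6)] [cite: SerreLocalFields1979, Ch. III §6 Prop. 13 and Remark]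
[cite: Serre1972, §1.11–§1.12] [cite: Mochizuki2012, IUTchIV Prop. 1.1 p. 9, Thm. 1.10 proof Step (iii) (R2)–(R4) p. 25–26]
[claim: Mochizuki2012, status: disputed] for every IUT quotation.
-/

noncomputable section

open NumberField IsDedekindDomain

namespace Summit.ABC.IUTFork.Conditional

/-! ## §3. DEDEKIND's different theorem read at a completion: `d(K_u) ≤ (e − 1 + e·v_p(e))/e` for EVERY place `u | p` of EVERY number field
(the tree's `multiplicity_differentIdeal_succ_le` — Neukirch III (2.6), `s ≤ e − 1 + ord_P(e)` — over `L = ℚ`, through abc-iut-S1's local–global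
bridge `differentOrd_rescaledCompletion`; the WILD upper bound the R-W numerics lead's «Lenstra max» `δ = e − 1 + e·v₃(e)` asks for) -/

section Dedekind

open Literature.IUT.LogVolume Literature.NumberTheory.NumberFields

variable (K : Type) [Field K] [NumberField K]

/-- The ramification index of a prime of `𝓞 K` over `𝓞 ℚ` is its ramification index over `ℤ` (`ℤ → 𝓞 ℚ` is onto, so the two extended ideals
in the localisation coincide) — re-derived from abc-iut's `CompletionLocalDegree` (private there). [folklore] -/
private theorem ramificationIdx_ringOfIntegersRat_eq_int (q : Ideal (𝓞 K)) :
    q.ramificationIdx (𝓞 ℚ) = q.ramificationIdx ℤ := by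
  by_cases hq : q.IsPrime
  · rw [Ideal.ramificationIdx_def, Ideal.ramificationIdx_def]
    have hsurj : Function.Surjective (algebraMap ℤ (𝓞 ℚ)) :=
      Rat.int_algebraMap_surjective _
    have hφ : algebraMap ℤ (Localization.AtPrime q) =
        (algebraMap (𝓞 ℚ) (Localization.AtPrime q)).comp (algebraMap ℤ (𝓞 ℚ)) :=
      RingHom.ext_int _ _
    have hunder : q.under ℤ = (q.under (𝓞 ℚ)).comap (algebraMap ℤ (𝓞 ℚ)) := by
      rw [Ideal.under_def, Ideal.under_def, Ideal.comap_comap, ← RingHom.ext_int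
        (algebraMap ℤ (𝓞 K)) ((algebraMap (𝓞 ℚ) (𝓞 K)).comp (algebraMap ℤ (𝓞 ℚ)))]
    have hI : (q.under ℤ).map (algebraMap ℤ (Localization.AtPrime q)) =
        (q.under (𝓞 ℚ)).map (algebraMap (𝓞 ℚ) (Localization.AtPrime q)) := by
      rw [hunder, hφ, ← Ideal.map_map, Ideal.map_comap_of_surjective _ hsurj]
    rw [hI]
  · rw [Ideal.ramificationIdx_of_not_isPrime q _ hq,
      Ideal.ramificationIdx_of_not_isPrime q _ hq]

/-- **`ord_u(𝔇_{K/ℤ}) ≤ e(u|p) − 1 + e(u|p)·v_p(e(u|p))`** at every finite place `u` of a number field `K` of residue characteristic `p`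
(Dedekind's different theorem, Neukirch III (2.6): `s + 1 ≤ e + ord_u(e)` with `ord_u(e) = e(u|p)·v_p(e)`; the tree's
`multiplicity_differentIdeal_succ_le` over `L = ℚ`, `𝔇_{K/𝓞_ℚ} = 𝔇_{K/ℤ}`, `multiplicity_span_natCast`). Tame (`p ∤ e`): `≤ e − 1`; `v_p(e) = 1`:
Lenstra's `≤ 2e − 1`. [cite: NeukirchANT1999, Ch. III (2.6)] [cite: SerreLocalFields1979, Ch. III §6 Prop. 13 and Remark] -/
theorem multiplicity_differentIdeal_int_le_dedekind (p : ℕ) [Fact p.Prime] (u : HeightOneSpectrum (𝓞 K))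
    (hu : ((p : ℕ) : 𝓞 K) ∈ u.asIdeal) :
    multiplicity u.asIdeal (differentIdeal ℤ (𝓞 K)) ≤
      u.asIdeal.ramificationIdx ℤ - 1 + u.asIdeal.ramificationIdx ℤ * (u.asIdeal.ramificationIdx ℤ).factorization p := by
  haveI := u.isMaximal
  have he0 : u.asIdeal.ramificationIdx ℤ ≠ 0 := (Ideal.ramificationIdx_pos u.asIdeal ℤ).ne'
  have h := multiplicity_differentIdeal_succ_le ℚ K u.asIdeal
  rw [← differentIdeal_int_eq_differentIdeal_ringOfIntegers_rat, ramificationIdx_ringOfIntegersRat_eq_int,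
    multiplicity_span_natCast K u.asIdeal he0] at h
  -- the residue characteristic of `u` is `p`
  have hnorm : Ideal.absNorm (u.asIdeal.under ℤ) = p := by
    have hdvd : Ideal.absNorm (u.asIdeal.under ℤ) ∣ p := (natCast_mem_iff_absNorm_under_dvd K u.asIdeal p).1 hu
    exact (Nat.prime_dvd_prime_iff_eq (Nat.absNorm_under_prime u.asIdeal) (Fact.out : p.Prime)).1 hdvd
  rw [hnorm] at h
  omega

/-- **`d(K_u) ≤ (e − 1 + e·v_p(e))/e`** for the rescaled completion of a number field `K` at a place `u | p` (`e = e(u|p)`): §3's exponent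
bound read through abc-iut-S1's `differentOrd_rescaledCompletion` (`d_u = ord_u(𝔇)/e`). [cite: NeukirchANT1999, Ch. III (2.6)]
[cite: Mochizuki2012, IUTchIV Prop. 1.1 p. 9 (the invariant `d`)] [claim: Mochizuki2012, status: disputed] -/
theorem differentOrd_rescaledCompletion_le_dedekind (p : ℕ) [Fact p.Prime] (u : HeightOneSpectrum (𝓞 K))
    (hu : ((p : ℕ) : 𝓞 K) ∈ u.asIdeal) :
    differentOrd p (RescaledCompletion K p u hu) ≤
      (((u.asIdeal.ramificationIdx ℤ - 1 + u.asIdeal.ramificationIdx ℤ * (u.asIdeal.ramificationIdx ℤ).factorization p : ℕ) : ℕ) : ℝ) /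
        (u.asIdeal.ramificationIdx ℤ : ℝ) := by
  rw [differentOrd_rescaledCompletion K p u hu]
  have he0 : (0 : ℝ) < (u.asIdeal.ramificationIdx ℤ : ℝ) := by exact_mod_cast Ideal.ramificationIdx_pos u.asIdeal ℤ
  exact div_le_div_of_nonneg_right (by exact_mod_cast multiplicity_differentIdeal_int_le_dedekind K p u hu) he0.le

end Dedekind

/-! ## §4. The local-type CLASS at a wild pole, WITHOUT pinning: `(p−1) ∣ A`, `15 ∣ A·t`, `A ∣ p(p−1)p′`, `p′ ∣ t ⇒ A ∣ p(p−1)` for `A = e(w | p)`,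
`{p, p′} = {3, 5}` — the hypotheses of abc-iut-W-neg-1's `wild_index_eq` BY NAME, with NO `p ∤ t` (type W1) assumption: at `p = 3` the class is
`A ∈ {10, 30}` (`5 ∤ t`) resp. `{2, 6}` (`5 ∣ t`) — so SPLIT (type W2, `q` a cube in `ℚ₃`) packets need no further local input on the NEGATIVE side -/

section WildClass

open Thm311 Thm311.Real Cor312 Cor312Prov Literature.IUT.LogVolume Literature.IUT.HodgeTheaters
  Literature.IUT.LogThetaLattice Literature.NumberTheory.NumberFields Literature.NumberTheory.DiophantineGeometry.GenEll
  Literature.NumberTheory.DiophantineGeometry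

/-- **The local-type class of a place `w ∣ p ∈ {3, 5}` of `F` over a pole of `j` of order `2t`** (genuine Θ-volume datum at a rational point;
NO hypothesis on `p ∣ t`): `A := e(w | p)` satisfies `(p − 1) ∣ A` (`μ₃₀ ⊂ F`, `ThetaVolumeDatumAt.sub_one_dvd_ramificationIdx_int`),
`15 ∣ A·t` (the `30`-th root of the Tate parameter, `fifteen_dvd_ramificationIdx_mul`), `A ∣ p(p−1)p′` and `p′ ∣ t ⇒ A ∣ p(p−1)` (Serre's line,
abc-iut-L5's `Cor22.ramificationIdx_subThetaField_dvd_wild` / `…_of_dvd_ord`). [cite: Serre1972, §1.11–§1.12]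
[cite: Mochizuki2012, IUTchIV Thm. 1.10 proof Step (iii) (R2)–(R4) p. 25–26] [claim: Mochizuki2012, status: disputed] -/
theorem GenuineK.ramificationIdx_F_wild_class_ratPoint {q₀ : ℚ} {l : ℕ} (T : Cor22.ThetaVolumeDatumAt (ratPoint q₀) l)
    {p p' : ℕ} (hpq : (p = 3 ∧ p' = 5) ∨ (p = 5 ∧ p' = 3)) {t : ℕ} (ht : 0 < t)
    (hpole : ∀ v : HeightOneSpectrum (𝓞 ℚ), Rat.HeightOneSpectrum.natGenerator v = p →
      Literature.IUT.LogVolume.ord ℚ v (Cor22.jInv q₀) = -(2 * (t : ℤ)))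
    (w : letI := T.instFieldF; letI := T.instNumberFieldF; HeightOneSpectrum (𝓞 T.F))
    (hw : letI := T.instFieldF; letI := T.instNumberFieldF; ((p : ℕ) : 𝓞 T.F) ∈ w.asIdeal) :
    letI := T.instFieldF; letI := T.instNumberFieldF
    (p - 1) ∣ w.asIdeal.ramificationIdx ℤ ∧ 15 ∣ w.asIdeal.ramificationIdx ℤ * t ∧
      w.asIdeal.ramificationIdx ℤ ∣ p * (p - 1) * p' ∧ (p' ∣ t → w.asIdeal.ramificationIdx ℤ ∣ p * (p - 1)) := by
  letI := T.instFieldF; letI := T.instNumberFieldF; letI := T.instAlgebraF; letI := T.instFieldK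
  letI := T.instNumberFieldK; letI := T.instAlgebraK; letI := T.instFieldFbar; letI := T.instAlgebraFbar
  letI := T.instAlgebraKFbar; letI := T.instIsElliptic
  have hp : p.Prime := by rcases hpq with ⟨rfl, -⟩ | ⟨rfl, -⟩ <;> norm_num
  have hp30 : p ∣ 30 := by rcases hpq with ⟨rfl, -⟩ | ⟨rfl, -⟩ <;> norm_num
  haveI : Fact p.Prime := ⟨hp⟩
  haveI : IsGalois (ratPoint q₀).F T.F := (T.towerFacts T.inU).1
  have ht0 : (0 : ℤ) < t := by exact_mod_cast ht
  -- the place `v₀` of `ℚ` under `w` is `p`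
  set v₀ : HeightOneSpectrum (𝓞 ℚ) := finBelow (ratPoint q₀).F T.F w with hv₀def
  have hchar : residueChar ℚ v₀ = p := by
    rw [hv₀def]
    change residueChar (ratPoint q₀).F (finBelow (ratPoint q₀).F T.F w) = p
    rw [residueChar_finBelow]
    exact residueChar_eq_of_natCast_mem p hw
  have hpv : ((p : ℕ) : 𝓞 ℚ) ∈ v₀.asIdeal := (Cor22.natCast_mem_asIdeal_iff_residueChar_eq v₀ hp).2 hchar
  have hvp : Rat.HeightOneSpectrum.natGenerator v₀ = p := by
    have hdvd := (UniformABCConjecture.natCast_mem_asIdeal_iff v₀ p).1 hpv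
    exact (Nat.prime_dvd_prime_iff_eq (Rat.HeightOneSpectrum.prime_natGenerator v₀) hp).1 hdvd
  have hord := hpole v₀ hvp
  have hbad : v₀ ∈ Cor22.badPlaces (ratPoint q₀) :=
    (Cor22.mem_badPlaces_iff_ord_neg (ratPoint q₀) v₀).2 (by
      show Literature.IUT.LogVolume.ord ℚ v₀ (Cor22.jInv q₀) < 0
      rw [hord]; linarith)
  have hp1 : Literature.IUT.LogVolume.ord ℚ v₀ (p : ℚ) = 1 := by
    rw [← hvp]
    exact Cor22.ord_natGenerator_eq_one v₀
  -- `e(w | p) = e(w | v₀)` over `ℚ`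
  have hew : w.asIdeal.ramificationIdx ℤ = w.asIdeal.ramificationIdx (𝓞 (ratPoint q₀).F) := by
    haveI : (finBelow (ratPoint q₀).F T.F w).asIdeal.IsMaximal := (finBelow (ratPoint q₀).F T.F w).isMaximal
    have h1 : ramIdx (ratPoint q₀).F (w.under (𝓞 (ratPoint q₀).F)) = 1 := by
      rw [ramIdx_eq]
      exact Literature.NumberTheory.EllipticCurves.Fisher2016.ramificationIdx_int_rat_eq_one _
    rw [ThetaData.absRamificationIdx_eq_ramIdx_mul (F := (ratPoint q₀).F) w]
    erw [h1, one_mul]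
    exact Ideal.ramificationIdx'_eq_ramificationIdx (finBelow (ratPoint q₀).F T.F w).asIdeal w.asIdeal
      (finBelow (ratPoint q₀).F T.F w).ne_bot
  -- UPPER: `e(w | v₀) ∣ p(p−1)p′`, and `∣ p(p−1)` when `p′ ∣ t`
  have hup : w.asIdeal.ramificationIdx (𝓞 (ratPoint q₀).F) ∣ p * (p - 1) * p' :=
    Cor22.ramificationIdx_subThetaField_dvd_wild T.F T.inU T.isSubThetaField w hbad hpq hpv hp1
  have hup' : p' ∣ t → w.asIdeal.ramificationIdx (𝓞 (ratPoint q₀).F) ∣ p * (p - 1) := fun hqt =>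
    Cor22.ramificationIdx_subThetaField_dvd_wild_of_dvd_ord T.F T.inU T.isSubThetaField w hbad hpq hpv hp1 (by
      show ((p' : ℕ) : ℤ) ∣ Literature.IUT.LogVolume.ord ℚ v₀ (Cor22.jInv q₀)
      rw [hord, dvd_neg]
      exact dvd_mul_of_dvd_right (Int.natCast_dvd_natCast.mpr hqt) 2)
  -- LOWER: `(p − 1) ∣ e(w | p)` and `15 ∣ e(w | v₀)·t`
  have h1 : (p - 1) ∣ w.asIdeal.ramificationIdx (𝓞 (ratPoint q₀).F) := by
    rw [← hew]
    exact T.sub_one_dvd_ramificationIdx_int hp hp30 w hw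
  have h15 : 15 ∣ w.asIdeal.ramificationIdx (𝓞 (ratPoint q₀).F) * t :=
    T.fifteen_dvd_ramificationIdx_mul w (by rw [← hv₀def]; exact hord) ht
  rw [hew]
  exact ⟨h1, h15, hup, hup'⟩

/-- **`(A·l)·v_p(A·l) ≤ [p ∣ A]·(A·l)`** for `A ∣ p·(p−1)·p′` (`{p, p′} = {3, 5}`) and a prime `l ≠ p` (`p² ∤ p(p−1)p′·l`): on the class of
`ramificationIdx_F_wild_class_ratPoint`, Dedekind's `e − 1 + e·v_p(e)` at `e = A·l` is `e − 1` (`p ∤ A`) or `2e − 1` (`p ∣ A`). [folklore] -/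
theorem GenuineK.mul_prime_factorization_le_ite {p p' A l : ℕ} (hpq : (p = 3 ∧ p' = 5) ∨ (p = 5 ∧ p' = 3)) (hl : l.Prime)
    (hpl : p ≠ l) (hA : A ∣ p * (p - 1) * p') :
    A * l * (A * l).factorization p ≤ if p ∣ A then A * l else 0 := by
  have hp : p.Prime := by rcases hpq with ⟨rfl, -⟩ | ⟨rfl, -⟩ <;> norm_num
  have hN0 : p * (p - 1) * p' ≠ 0 := by rcases hpq with ⟨rfl, rfl⟩ | ⟨rfl, rfl⟩ <;> norm_num
  have hA0 : A ≠ 0 := by rintro rfl; exact hN0 (zero_dvd_iff.mp hA)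
  have hAl0 : A * l ≠ 0 := Nat.mul_ne_zero hA0 hl.ne_zero
  have hpl' : ¬ p ∣ l := fun h => hpl ((Nat.prime_dvd_prime_iff_eq hp hl).1 h)
  -- `p² ∤ p(p−1)p′·l`, hence `p² ∤ A·l`
  have hrest : ¬ p ∣ (p - 1) * p' * l := by
    intro h
    rcases (Nat.Prime.dvd_mul hp).1 h with h1 | h1
    · rcases (Nat.Prime.dvd_mul hp).1 h1 with h2 | h2
      · rcases hpq with ⟨rfl, -⟩ | ⟨rfl, -⟩ <;> omega
      · rcases hpq with ⟨rfl, rfl⟩ | ⟨rfl, rfl⟩ <;> omega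
    · exact hpl' h1
  have hsq : ¬ p ^ 2 ∣ A * l := by
    intro h
    have h' : p ^ 2 ∣ p * ((p - 1) * p' * l) := by
      have : A * l ∣ p * (p - 1) * p' * l := Nat.mul_dvd_mul_right hA l
      rw [show p * (p - 1) * p' * l = p * ((p - 1) * p' * l) by ring] at this
      exact h.trans this
    rw [pow_two] at h'
    exact hrest ((Nat.mul_dvd_mul_iff_left hp.pos).1 h')
  have hle : (A * l).factorization p ≤ 1 := by
    by_contra hlt
    push Not at hlt
    exact hsq ((hp.pow_dvd_iff_le_factorization hAl0).2 hlt)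
  split_ifs with hpA
  · calc A * l * (A * l).factorization p ≤ A * l * 1 := Nat.mul_le_mul_left _ hle
      _ = A * l := mul_one _
  · have : ¬ p ∣ A * l := fun h => by
      rcases (Nat.Prime.dvd_mul hp).1 h with h1 | h1
      · exact hpA h1
      · exact hpl' h1
    rw [Nat.factorization_eq_zero_of_not_dvd this, mul_zero]


end WildClass

end Summit.ABC.IUTFork.Conditional

end
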